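import Literature.Topology.FourManifolds.TrisectionsSectorRecognition
import Literature.Topology.FourManifolds.MorseBirthInsertion
import Literature.Topology.FourManifolds.MorseProofs
import Literature.Topology.FourManifolds.FlowFibreMorseAlgebra
import HarnessLib

/-!
# Preliminaries for the stabilisation implant: generic lemmas

Topic `Literature/Topology/FourManifolds`; infrastructure for the fact seat
`provefact-Literature.Topology.FourManifolds.exists-14560f9fc8` (named fact (c′)
`Literature.Topology.FourManifolds.exists_stabilized_gkTrisection`, Gay–Kirby 2016, Def. 8 and
Lemma 10).  Everything in this file is **proved**; no definitions, no named facts.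

Generic lemmas used when the implant model (`TrisectionsImplantModel.lean`) is glued into a
closed `4`-manifold through a chart:

* `finite_interior_inter_criticalSet` — for an ambient presentation of a sector, the set of
  interior critical points is finite (closed by the regularity of the face and corner points,
  discrete since nondegenerate critical points are isolated,
  `eventually_not_isMCriticalPt_of_nondegenerate`);
* `mem_closure_setOf_lt_zero_of_not_isMCriticalPt` — a regular zero of a smooth function lies in
  the closure of the set where the function is negative;
* `mem_interior_iff_of_inter_eq` — the interior is local;
* `exists_halfSliceChart_of_inter_eq` — a half-slice chart of `S` restricted to an open set on
  which `S` and `S'` agree is a half-slice chart of `S'`;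
* `morseData_of_comp_symm_eventuallyEq` — criticality, nondegeneracy and index of `G` at a point
  of a chart of the maximal atlas in which `G ∘ Θ⁻¹` agrees with a model function `g` near the
  image point are those of `g` (`exists_mhessian_apply_eq_fderiv_fderiv_comp_symm`);
* `morseData_const_add_smul` — on the model space, `a + b g` (`b > 0`) has the critical points,
  nondegeneracy and indices of `g`.

## References

* J. Milnor, *Morse theory*, Ann. of Math. Studies 51 (1963), §2 and Cor. 2.3. [Milnor1963]
* D. Gay, R. Kirby, *Trisecting 4-manifolds*, Geom. Topol. 20 (2016) 3097–3132, Def. 8.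
  [GayKirby2016]
-/

open scoped Manifold ContDiff Topology
open Set Function Filter

noncomputable section

namespace Literature.Topology.FourManifolds

universe u

section Generic

variable {X : Type u} [TopologicalSpace X] [ChartedSpace (EuclideanSpace ℝ (Fin 4)) X]

/-! ### Finiteness of the interior critical set -/

/-- **The interior critical points of an ambient presentation of a sector are finitely many.**
If `S` is compact, `G` is smooth, the non-interior points of `S` off `F` are regular, no
critical point lies on `S ∩ Oκ ∖ F` for an open `Oκ ⊇ F` whose points of `F` are not interior
to `S`, and the interior critical points are nondegenerate, then
`interior S ∩ criticalSet G` is finite: it is closed (hence compact) and discrete.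
[cite: Milnor1963, Cor. 2.3] -/
theorem finite_interior_inter_criticalSet [T2Space X] [CompactSpace X] [IsManifold (𝓡 4) ∞ X]
    {S F Oκ : Set X} (hSc : IsCompact S) {G : X → ℝ} (hGs : ContMDiff (𝓡 4) 𝓘(ℝ, ℝ) ∞ G)
    (hOκo : IsOpen Oκ) (hFOκ : F ⊆ Oκ) (hFnotint : ∀ x ∈ F, x ∉ interior S)
    (hb2 : ∀ p ∈ S, p ∉ interior S → p ∉ F → ¬ IsMCriticalPt (𝓡 4) G p)
    (hnocrit : ∀ p ∈ S, p ∈ Oκ → p ∉ F → ¬ IsMCriticalPt (𝓡 4) G p)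
    (hi2 : ∀ p ∈ interior S, IsMCriticalPt (𝓡 4) G p → (mhessian (𝓡 4) G p).Nondegenerate) :
    (interior S ∩ criticalSet (𝓡 4) G).Finite := by
  set Z : Set X := interior S ∩ criticalSet (𝓡 4) G with hZ
  have hcritcl : IsClosed (criticalSet (𝓡 4) G) := isClosed_criticalSet_of_contMDiff hGs (by norm_cast)
  -- `Z` is closed
  have hZcl : IsClosed Z := by
    rw [← closure_subset_iff_isClosed]
    intro q hq
    have hqS : q ∈ S := closure_minimal (inter_subset_left.trans interior_subset) hSc.isClosed hq
    have hqcrit : q ∈ criticalSet (𝓡 4) G := closure_minimal inter_subset_right hcritcl hq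
    refine ⟨?_, hqcrit⟩
    by_contra hqint
    by_cases hqF : q ∈ F
    · -- some point of `Z` lies in `Oκ`
      obtain ⟨z, hzZ, hzO⟩ : (Z ∩ Oκ).Nonempty := by
        have := mem_closure_iff_nhds.1 hq Oκ (hOκo.mem_nhds (hFOκ hqF))
        rwa [inter_comm] at this
      exact hnocrit z (interior_subset hzZ.1) hzO (fun hzF => hFnotint z hzF hzZ.1) hzZ.2
    · exact hb2 q hqS hqint hqF hqcrit
  have hZc : IsCompact Z := hZcl.isCompact
  -- every point of `Z` is isolated in `Z`
  have hiso : ∀ p ∈ Z, ∃ U : Set X, U ∈ 𝓝 p ∧ U ∩ Z ⊆ {p} := by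
    rintro p ⟨hpint, hpcrit⟩
    have hev := eventually_not_isMCriticalPt_of_nondegenerate (I := 𝓡 4) hGs (by norm_cast) hpcrit
      (hi2 p hpint hpcrit)
    rw [eventually_nhdsWithin_iff] at hev
    refine ⟨{x | x ∈ ({p}ᶜ : Set X) → ¬ IsMCriticalPt (𝓡 4) G x}, hev, ?_⟩
    rintro x ⟨hx, hxZ⟩
    by_contra hxp
    exact hx hxp hxZ.2
  choose! U hU hUZ using hiso
  obtain ⟨t, htZ, hcover⟩ := hZc.elim_nhds_subcover U fun p hp => hU p hp
  refine (t.finite_toSet).subset fun z hz => ?_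
  obtain ⟨p, hpt, hzU⟩ := mem_iUnion₂.1 (hcover hz)
  have : z ∈ ({p} : Set X) := hUZ p (htZ p hpt) ⟨hzU, hz⟩
  rw [mem_singleton_iff.1 this]
  exact hpt

/-! ### A regular zero lies in the closure of the negative set -/

/-- **A regular zero of a smooth function lies in the closure of `{f < 0}`** (and, applied to
`-f`, of `{f > 0}`): along a chart line on which the derivative is negative the function takes
negative values arbitrarily close to the point. [folklore] -/
theorem mem_closure_setOf_lt_zero_of_not_isMCriticalPt [IsManifold (𝓡 4) ∞ X] {f : X → ℝ}
    (hf : ContMDiff (𝓡 4) 𝓘(ℝ, ℝ) ∞ f) {p : X} (hp0 : f p = 0) (hreg : ¬ IsMCriticalPt (𝓡 4) f p) :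
    p ∈ closure {y | f y < 0} := by
  set φ := extChartAt (𝓡 4) p with hφ
  set z₀ : EuclideanSpace ℝ (Fin 4) := φ p with hz₀
  set g : EuclideanSpace ℝ (Fin 4) → ℝ := f ∘ φ.symm with hg
  have htgt : IsOpen φ.target := isOpen_extChartAt_target p
  have hz₀t : z₀ ∈ φ.target := mem_extChartAt_target p
  -- `g` is differentiable at `z₀` with nonzero derivative
  have hfd : MDifferentiableAt (𝓡 4) 𝓘(ℝ, ℝ) f p := hf.mdifferentiableAt (by simp)
  have hgd : DifferentiableAt ℝ g z₀ := by
    have h := hfd.differentiableWithinAt_writtenInExtChartAt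
    rw [ModelWithCorners.Boundaryless.range_eq_univ, differentiableWithinAt_univ] at h
    exact h
  have hgne : fderiv ℝ g z₀ ≠ 0 := by
    intro h0
    apply hreg
    show mfderiv (𝓡 4) 𝓘(ℝ, ℝ) f p = 0
    rw [hfd.mfderiv, ModelWithCorners.Boundaryless.range_eq_univ, fderivWithin_univ]
    exact h0
  -- a direction of negative derivative
  obtain ⟨w, hw⟩ : ∃ w : EuclideanSpace ℝ (Fin 4), fderiv ℝ g z₀ w < 0 := by
    by_contra hall
    push Not at hall
    apply hgne
    ext w
    have h1 := hall w
    have h2 := hall (-w)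
    rw [map_neg] at h2
    simp only [zero_apply]
    linarith
  -- along the line the function becomes negative
  have hline : HasDerivAt (fun s : ℝ => g (z₀ + s • w)) (fderiv ℝ g z₀ w) 0 := by
    have h := hgd.hasFDerivAt.hasLineDerivAt w
    unfold HasLineDerivAt at h
    exact h
  have hg0 : g z₀ = 0 := by simp [hg, hz₀, hφ, hp0]
  rw [hasDerivAt_iff_tendsto_slope] at hline
  have hev : ∀ᶠ s in 𝓝[>] (0:ℝ), g (z₀ + s • w) < 0 := by
    have h1 : ∀ᶠ s in 𝓝[≠] (0:ℝ), slope (fun s : ℝ => g (z₀ + s • w)) 0 s < 0 :=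
      hline.eventually_lt_const hw
    have h2 : ∀ᶠ s in 𝓝[>] (0:ℝ), slope (fun s : ℝ => g (z₀ + s • w)) 0 s < 0 :=
      h1.filter_mono (nhdsWithin_mono _ fun s hs => ne_of_gt hs)
    filter_upwards [h2, self_mem_nhdsWithin] with s hs hs0
    have hs0' : (0:ℝ) < s := hs0
    rw [slope_def_field] at hs
    simp only [zero_smul, add_zero, hg0, sub_zero] at hs
    rcases div_neg_iff.1 hs with ⟨_, hneg⟩ | ⟨hlt, _⟩
    · linarith
    · exact hlt
  -- the curve back in `X`
  have hcurve : Tendsto (fun s : ℝ => φ.symm (z₀ + s • w)) (𝓝[>] 0) (𝓝 p) := by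
    have h1 : Tendsto (fun s : ℝ => z₀ + s • w) (𝓝 0) (𝓝 z₀) := by
      have : Continuous fun s : ℝ => z₀ + s • w := by fun_prop
      simpa using this.tendsto 0
    have h2 : ContinuousAt φ.symm z₀ := continuousAt_extChartAt_symm p
    have h3 := h2.tendsto.comp h1
    rw [hz₀, hφ, extChartAt_to_inv] at h3
    exact h3.mono_left nhdsWithin_le_nhds
  refine mem_closure_of_tendsto hcurve ?_
  have htarget : ∀ᶠ s in 𝓝[>] (0:ℝ), z₀ + s • w ∈ φ.target := by
    have h1 : Tendsto (fun s : ℝ => z₀ + s • w) (𝓝 0) (𝓝 z₀) := by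
      have : Continuous fun s : ℝ => z₀ + s • w := by fun_prop
      simpa using this.tendsto 0
    exact (h1.eventually (htgt.mem_nhds hz₀t)).filter_mono nhdsWithin_le_nhds
  filter_upwards [hev, htarget] with s hs _
  exact hs

/-! ### Locality of the interior -/

omit [ChartedSpace (EuclideanSpace ℝ (Fin 4)) X] in
/-- The interior is local: if `S ∩ V = S' ∩ V` for an open `V ∋ y`, then `y` is interior to `S`
iff it is interior to `S'`. [folklore] -/
theorem mem_interior_iff_of_inter_eq {S S' V : Set X} (hV : IsOpen V) (h : S ∩ V = S' ∩ V)
    {y : X} (hy : y ∈ V) : y ∈ interior S ↔ y ∈ interior S' := by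
  have key : ∀ (A B : Set X), A ∩ V = B ∩ V → y ∈ interior A → y ∈ interior B := by
    intro A B hAB hyA
    have h1 : y ∈ interior (A ∩ V) := by
      rw [interior_inter, hV.interior_eq]; exact ⟨hyA, hy⟩
    rw [hAB, interior_inter] at h1
    exact h1.1
  exact ⟨key S S' h, key S' S h.symm⟩

/-! ### Transferring half-slice charts -/

omit [ChartedSpace (EuclideanSpace ℝ (Fin 4)) X] in
/-- **A half-slice chart of `S`, restricted to an open set on which `S` and `S'` agree, is a
half-slice chart of `S'`.** [folklore] -/
theorem exists_halfSliceChart_of_inter_eq [ChartedSpace (EuclideanSpace ℝ (Fin 4)) X]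
    {S S' : Set X} (D : HalfSliceChart (𝓡 4) S) {V : Set X} (hV : IsOpen V)
    (h : ∀ q ∈ V, q ∈ S ↔ q ∈ S') :
    ∃ D' : HalfSliceChart (𝓡 4) S', D'.Θ.source = D.Θ.source ∩ V ∧ ∀ q, D'.Θ q = D.Θ q := by
  refine ⟨{ Θ := D.Θ.restrOpen V hV
            contMDiffOn_toFun := D.contMDiffOn_toFun.mono (by
              rw [OpenPartialHomeomorph.restrOpen_source]; exact inter_subset_left)
            contMDiffOn_symm := D.contMDiffOn_symm.mono (by
              rw [OpenPartialHomeomorph.restrOpen_toPartialEquiv, PartialEquiv.restr_target]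
              exact inter_subset_left)
            mem_iff := fun q hq => by
              rw [OpenPartialHomeomorph.restrOpen_source] at hq
              rw [← h q hq.2]
              exact D.mem_iff q hq.1 }, ?_, fun q => rfl⟩
  show (D.Θ.restrOpen V hV).source = D.Θ.source ∩ V
  rw [OpenPartialHomeomorph.restrOpen_source]

/-! ### Morse data through a chart of the maximal atlas -/

/-- **Morse data read in a chart in which the function is a model function.**  Let `Θ` be a
chart of the maximal `C^∞` atlas, `x ∈ Θ.source`, and suppose `G ∘ Θ⁻¹` agrees with a
model function `g` near `Θ x`.  Then `x` is critical for `G` iff `Θ x` is critical for `g` (on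
the model space), and in that case the Hessians are congruent: `G` is nondegenerate at `x` iff
`g` is at `Θ x`, with the same index. [cite: Milnor1963, §2] -/
theorem morseData_of_comp_symm_eventuallyEq [IsManifold (𝓡 4) ∞ X]
    {Θ : OpenPartialHomeomorph X (EuclideanSpace ℝ (Fin 4))}
    (hΘ : Θ ∈ IsManifold.maximalAtlas (𝓡 4) ∞ X) {G : X → ℝ} (hGs : ContMDiff (𝓡 4) 𝓘(ℝ, ℝ) ∞ G)
    {g : EuclideanSpace ℝ (Fin 4) → ℝ} {x : X} (hx : x ∈ Θ.source)
    (heq : (G ∘ Θ.symm) =ᶠ[𝓝 (Θ x)] g) :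
    (IsMCriticalPt (𝓡 4) G x ↔ IsMCriticalPt (𝓡 4) g (Θ x)) ∧
    (IsMCriticalPt (𝓡 4) G x →
      ((mhessian (𝓡 4) G x).Nondegenerate ↔ (mhessian (𝓡 4) g (Θ x)).Nondegenerate) ∧
      morseIndex (𝓡 4) G x = morseIndex (𝓡 4) g (Θ x)) := by
  have hmem2 : Θ ∈ IsManifold.maximalAtlas (𝓡 4) 2 X :=
    IsManifold.maximalAtlas_subset_of_le (M := X) (I := 𝓡 4) ENat.LEInfty.out hΘ
  have hcrit_iff : IsMCriticalPt (𝓡 4) G x ↔ fderiv ℝ (G ∘ Θ.symm) (Θ x) = 0 := by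
    rw [isMCriticalPt_iff_fderiv_comp_extend_symm_eq_zero (I := 𝓡 4)
      ((hGs.contMDiffAt (x := x)).of_le ENat.LEInfty.out) hmem2 hx]
    have h1 : (G ∘ (Θ.extend (𝓡 4)).symm) = G ∘ Θ.symm := by ext w; simp
    have h2 : Θ.extend (𝓡 4) x = Θ x := by simp
    rw [h1, h2]
  have hiff : IsMCriticalPt (𝓡 4) G x ↔ IsMCriticalPt (𝓡 4) g (Θ x) := by
    rw [hcrit_iff, heq.fderiv_eq, MorseBirth.isMCriticalPt_iff_fderiv]
  refine ⟨hiff, fun hcrit => ?_⟩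
  -- smoothness of `Θ` both ways
  have hΘs : ContMDiffOn (𝓡 4) 𝓘(ℝ, EuclideanSpace ℝ (Fin 4)) ∞ Θ Θ.source :=
    contMDiffOn_of_mem_maximalAtlas hΘ
  have hΘs' : ContMDiffOn 𝓘(ℝ, EuclideanSpace ℝ (Fin 4)) (𝓡 4) ∞ Θ.symm Θ.target :=
    contMDiffOn_symm_of_mem_maximalAtlas hΘ
  obtain ⟨L, hL⟩ := exists_mhessian_apply_eq_fderiv_fderiv_comp_symm (I := 𝓡 4) hΘs hΘs' hGs hx
    (BoundarylessManifold.isInteriorPoint (I := 𝓡 4)) hcrit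
  have hL' : ∀ v w, mhessian (𝓡 4) G x v w = mhessian (𝓡 4) g (Θ x) (L v) (L w) := by
    intro v w
    rw [hL v w, MorseBirth.mhessian_model_apply, heq.fderiv.fderiv_eq]
  refine ⟨nondegenerate_iff_of_forall_apply_eq L.toLinearEquiv hL', ?_⟩
  unfold morseIndex
  exact sigNeg_eq_of_forall_apply_eq L.toLinearEquiv hL'

/-! ### `a + b g` has the Morse data of `g` -/

/-- On the model space `ℝ⁴`, the function `a + b · g` (`b > 0`, `g` of class `C²`) has the same
critical points as `g`, with the same nondegeneracy and the same indices. [cite: Milnor1963, §2] -/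
theorem morseData_const_add_smul {g : EuclideanSpace ℝ (Fin 4) → ℝ} (hg : ContDiff ℝ 2 g)
    {a b : ℝ} (hb : 0 < b) (z : EuclideanSpace ℝ (Fin 4)) :
    (IsMCriticalPt (𝓡 4) (fun y => a + b * g y) z ↔ IsMCriticalPt (𝓡 4) g z) ∧
    ((mhessian (𝓡 4) (fun y => a + b * g y) z).Nondegenerate ↔ (mhessian (𝓡 4) g z).Nondegenerate) ∧
    morseIndex (𝓡 4) (fun y => a + b * g y) z = morseIndex (𝓡 4) g z := by
  have hgd : Differentiable ℝ g := hg.differentiable (by norm_num)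
  have hfd : ∀ y, fderiv ℝ (fun y => a + b * g y) y = b • fderiv ℝ g y := by
    intro y
    have h := ((hgd y).hasFDerivAt.const_mul b).const_add a
    rw [h.fderiv]
  have hfd' : fderiv ℝ (fun y => a + b * g y) = fun y => b • fderiv ℝ g y := funext hfd
  -- second derivatives
  have hg2 : Differentiable ℝ (fderiv ℝ g) :=
    (hg.fderiv_right (m := 1) (by norm_num)).differentiable (by simp)
  have hfd2 : fderiv ℝ (fderiv ℝ (fun y => a + b * g y)) z = b • fderiv ℝ (fderiv ℝ g) z := by
    rw [hfd']
    exact ((hg2 z).hasFDerivAt.const_smul b).fderiv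
  have hB : ∀ v w, mhessian (𝓡 4) (fun y => a + b * g y) z v w = (b • mhessian (𝓡 4) g z) v w := by
    intro v w
    rw [MorseBirth.mhessian_model_apply, hfd2]
    simp only [smul_apply, LinearMap.smul_apply, MorseBirth.mhessian_model_apply, smul_eq_mul]
  have hBeq : mhessian (𝓡 4) (fun y => a + b * g y) z = b • mhessian (𝓡 4) g z := by
    ext v w; exact hB v w
  refine ⟨?_, ?_, ?_⟩
  · rw [MorseBirth.isMCriticalPt_iff_fderiv, MorseBirth.isMCriticalPt_iff_fderiv, hfd,
      smul_eq_zero]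
    simp [hb.ne']
  · rw [hBeq]; exact LinearMap.BilinForm.nondegenerate_smul_iff _ hb.ne'
  · unfold morseIndex
    rw [hBeq]
    exact LinearMap.BilinForm.sigNeg_smul_of_pos' _ hb

end Generic

end Literature.Topology.FourManifolds
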